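/-
Copyright: the b2b-balaban T⁴-continuum CRUX team, row NE7b OWNER lineage `t4-ne7b-p1` (gen 134). Project licence.
-/
import Summits.QuantumFields.BalabanUV.T4Continuum.Spine.NE7b.SupGraphDistanceLipschitz
import Summits.QuantumFields.BalabanUV.T4Continuum.Spine.NE7b.SupTorusBlockDistance

/-!
# THE TORUS INSTANCE: CUBES OF SIDE `n+1` ON `(ℤ∕(n+1)s)^d` SATISFY THE LARGE-SET SEPARATION — so (360)'s weight regeneration is NOT vacuous on
# the road's tori.  Cells = sites of the fine torus `Fin d → ZMod ((n+1)s)` with the `ℓ^∞` adjacency (`|valMinAbs(a_i − b_i)| ≤ 1` in every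
# coordinate); blocks = sites of the coarse torus `Fin d → ZMod s`, block of `x` = `(⌊val(x_i)∕(n+1)⌋)_i`, block adjacency again `ℓ^∞`.  Then:
# (i) two cells whose blocks are NOT `ℓ^∞`-adjacent differ, in some coordinate, by a circular size `≥ n + 2` ((132)'s `coord_compare`: a fine
# difference inside blocks `D` apart is `(n+1)·|D|_∘ ± n`); (ii) the coordinate circular size `a ↦ |valMinAbs(a_i − y_i)|` is Lipschitz under
# `ℓ^∞`-steps; (iii) the `ℓ^∞`-neighbourhood of a block has `≤ 3^d` blocks.  Hence by (365):
#   `⌊((n+1)∕2 + 1)∕(3^d + 1)⌋·(#B(Y) − (3^d + 1)) + 1 ≤ #Y`   for every `ℓ^∞`-connected cell set `Y` of the fine torus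
# — (360)'s `hsep` with `m = 3^d + 1`, `ℓ = ⌊((n+1)∕2 + 1)∕(3^d + 1)⌋ ~ L∕(2·3^d)` for blocks of side `L = n + 1` (row NE7b, node U5c; (365) + (132)
# BY NAME, Mathlib's `ZMod.valMinAbs` kit; [folklore])

Cell `pub-balaban`, sub-cell `t4`, spine estimate NE7b (`T4WeightBudget.RelWeightBound`; the cell's OWN estimate — NOT PRINTED in
[Bałaban 1983–89], NOT PROVED).  Crux-route work under `Spine/NE7b/` by the row OWNER (`t4-ne7b-p1` gen 134, file (366)) under FREEZE
(0)'s crux-prover clause, on `g134/records/SCOPING-d6-iteration.md` DECISION (4); NOTHING of Bałaban's is named as a Lean object, valued or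
asserted; no `T4Continuum/Support` leaf typed; no `def`, no notation (block map, adjacencies and potentials written out); zero `sorry`.  Imports
(BY NAME): the OWNER's (365) `…SupGraphDistanceLipschitz` (`largeSet_separation_of_potentials`), (132) `…SupTorusBlockDistance` (`coord_compare`,
`natAbs_valMinAbs_add_le'`); Mathlib's `ZMod.valMinAbs` (`natAbs_valMinAbs_neg`, `valMinAbs_zero`, `injective_valMinAbs`, `natCast_zmod_val`),
`Nat.div_add_mod`, `Fintype.piFinset`, `Fintype.card_piFinset_const`, `Finset.card_le_card_of_injOn`.

WHAT IS PROVED ([folklore]; fine torus `Fin d → ZMod ((n+1)s)`, coarse torus `Fin d → ZMod s`, `s ≥ 1`):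
* §1 `fine_eq_cast` (`x_i = ↑((n+1)·⌊val x_i∕(n+1)⌋ + val x_i % (n+1))`), **`coord_gap_of_far_blocks`** (`2 ≤ |valMinAbs(B(x)_i − B(y)_i)| ⟹
  n + 2 ≤ |valMinAbs(x_i − y_i)|`), **`lipschitz_coordSize`** (`|valMinAbs(a_i − b_i)| ≤ 1 ⟹ ||valMinAbs(a_i − y_i)| − |valMinAbs(b_i − y_i)|| ≤ 1`),
  **`card_linfNbr_le`** (`#{b : ∀ i, |valMinAbs(b_i − a_i)| ≤ 1} ≤ 3^d`);
* §2 THE END **`torus_largeSet_separation`** (`⌊((n+1)∕2 + 1)∕(3^d+1)⌋·(#B(Y) − (3^d+1)) + 1 ≤ #Y` for every `ℓ^∞`-connected `Y`); §3 toy.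

HONEST (what this is NOT).  Lattice combinatorics on the road's tori (the cells here are SITES with `ℓ^∞` adjacency; for cells that are themselves
blocks of sites the same argument runs one level up); no analysis; the small sets (`#B(Y) ≤ 3^d + 1`) gain nothing — renormalisation, NC-NE7b-α
UNRULED; scalar skeleton ((A3)); nothing of Bałaban's asserted.  BY-NAME EFFECT ON THE WALL: NONE.  NE7b NOT PRINTED ∕ NOT PROVED; spine PROVED 0∕9;
rung (B)+1 — the programme's measures remain FINITE-torus statements; NOT the mass gap, NOT Clay.  HONEST DEPENDENCY: continuum YM on T⁴ ⇐ BetaPertH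
∧ nine spine estimates (0∕9 proved); BetaPertH ⇐ (D1) ∧ (D4) ∧ CAP+tail; G-an2-4 gates asym, D1 and NE2∕3∕4.
-/

set_option autoImplicit false

namespace Summit.QuantumFields.BalabanUV.T4Continuum.NE7b.SupTorusCubeSeparation

open Finset
open Literature.Probability.LatticeModels
open SupGraphDistanceLipschitz (largeSet_separation_of_potentials)
open SupTorusBlockDistance (coord_compare natAbs_valMinAbs_add_le')

variable {d n s : ℕ} [NeZero s] [NeZero ((n + 1) * s)]

/-! ## §1. Coordinates: fine versus coarse, Lipschitz sizes, `ℓ^∞` neighbourhoods -/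

omit [NeZero s] in
/-- A fine residue is the cast of `(n+1)·quotient + remainder` of its value. [folklore] -/
theorem fine_eq_cast (a : ZMod ((n + 1) * s)) : a = (((n + 1) * (a.val / (n + 1)) + a.val % (n + 1) : ℕ) : ZMod ((n + 1) * s)) := by
  rw [Nat.div_add_mod, ZMod.natCast_zmod_val]

/-- **FAR BLOCKS FORCE A COORDINATE GAP**: if the blocks of `x` and `y` are `≥ 2` apart (circularly) in coordinate `i`, then
`n + 2 ≤ |valMinAbs(x_i − y_i)|`. [folklore] -/
theorem coord_gap_of_far_blocks (x y : Fin d → ZMod ((n + 1) * s)) (i : Fin d)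
    (hfar : 2 ≤ ((((x i).val / (n + 1) : ℕ) : ZMod s) - (((y i).val / (n + 1) : ℕ) : ZMod s)).valMinAbs.natAbs) :
    n + 2 ≤ ((x i - y i).valMinAbs.natAbs) := by
  set qx : ℕ := (x i).val / (n + 1) with hqx
  set zx : ℕ := (x i).val % (n + 1) with hzx
  set qy : ℕ := (y i).val / (n + 1) with hqy
  set zy : ℕ := (y i).val % (n + 1) with hzy
  have hzx' : zx < n + 1 := Nat.mod_lt _ (Nat.succ_pos n)
  have hzy' : zy < n + 1 := Nat.mod_lt _ (Nat.succ_pos n)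
  have hδ : |((zx : ℤ) - zy)| ≤ n := by rw [abs_le]; constructor <;> omega
  have ha : (((qx : ℤ) - qy : ℤ) : ZMod s) = ((qx : ℕ) : ZMod s) - ((qy : ℕ) : ZMod s) := by push_cast; ring
  have hb : ((((n : ℤ) + 1) * ((qx : ℤ) - qy) + ((zx : ℤ) - zy) : ℤ) : ZMod ((n + 1) * s)) = x i - y i := by
    conv_rhs => rw [fine_eq_cast (x i), fine_eq_cast (y i)]
    simp only [← hqx, ← hqy, ← hzx, ← hzy]
    push_cast
    ring
  have h := (coord_compare n ((qx : ℤ) - qy) ((zx : ℤ) - zy) hδ _ ha _ hb).1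
  have hfar' : (2 : ℤ) ≤ (((((qx : ℕ) : ZMod s) - ((qy : ℕ) : ZMod s)).valMinAbs.natAbs : ℕ) : ℤ) := by exact_mod_cast hfar
  have h2 : ((n : ℤ) + 2 : ℤ) ≤ ((x i - y i).valMinAbs.natAbs : ℤ) := by nlinarith
  exact_mod_cast h2

omit [NeZero s] [NeZero ((n + 1) * s)] in
/-- **THE COORDINATE CIRCULAR SIZE IS LIPSCHITZ UNDER `ℓ^∞`-STEPS**: `|valMinAbs(a_i − b_i)| ≤ 1 ⟹`
`| |valMinAbs(a_i − y_i)| − |valMinAbs(b_i − y_i)| | ≤ 1` (subadditivity of the circular size). [folklore] -/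
theorem lipschitz_coordSize {N : ℕ} (a b y : Fin d → ZMod N) (i : Fin d) (h : (a i - b i).valMinAbs.natAbs ≤ 1) :
    |(((a i - y i).valMinAbs.natAbs : ℕ) : ℤ) - (((b i - y i).valMinAbs.natAbs : ℕ) : ℤ)| ≤ 1 := by
  have h1 : (a i - y i).valMinAbs.natAbs ≤ (a i - b i).valMinAbs.natAbs + (b i - y i).valMinAbs.natAbs := by
    have := natAbs_valMinAbs_add_le' (a i - b i) (b i - y i)
    rwa [sub_add_sub_cancel] at this
  have h2 : (b i - y i).valMinAbs.natAbs ≤ (b i - a i).valMinAbs.natAbs + (a i - y i).valMinAbs.natAbs := by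
    have := natAbs_valMinAbs_add_le' (b i - a i) (a i - y i)
    rwa [sub_add_sub_cancel] at this
  have h3 : (b i - a i).valMinAbs.natAbs = (a i - b i).valMinAbs.natAbs := by rw [← neg_sub, ZMod.natAbs_valMinAbs_neg]
  rw [h3] at h2
  set A := (a i - y i).valMinAbs.natAbs with hA
  set B := (b i - y i).valMinAbs.natAbs with hB
  set C := (a i - b i).valMinAbs.natAbs with hC
  rw [abs_sub_le_iff]
  constructor <;> omega

omit [NeZero ((n + 1) * s)] in
/-- **AN `ℓ^∞`-NEIGHBOURHOOD HAS AT MOST `3^d` SITES**: `#{b : ∀ i, |valMinAbs(b_i − a_i)| ≤ 1} ≤ 3^d` (inject by the coordinatewise centred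
representatives into `{−1,0,1}^d`). [folklore] -/
theorem card_linfNbr_le (a : Fin d → ZMod s) :
    ((Finset.univ : Finset (Fin d → ZMod s)).filter fun b => ∀ i, (b i - a i).valMinAbs.natAbs ≤ 1).card ≤ 3 ^ d := by
  classical
  have hinj : Set.InjOn (fun (b : Fin d → ZMod s) (i : Fin d) => (b i - a i).valMinAbs)
      ↑((Finset.univ : Finset (Fin d → ZMod s)).filter fun b => ∀ i, (b i - a i).valMinAbs.natAbs ≤ 1) := by
    intro b _ b' _ hbb'
    funext i
    have hi := congrFun hbb' i
    have : b i - a i = b' i - a i := ZMod.injective_valMinAbs hi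
    exact sub_left_injective this
  have hmaps : ∀ b ∈ (Finset.univ : Finset (Fin d → ZMod s)).filter (fun b => ∀ i, (b i - a i).valMinAbs.natAbs ≤ 1),
      (fun i : Fin d => (b i - a i).valMinAbs) ∈ Fintype.piFinset fun _ : Fin d => Finset.Icc (-1 : ℤ) 1 := by
    intro b hb
    rw [Fintype.mem_piFinset]
    intro i
    have hi := (mem_filter.1 hb).2 i
    rw [Finset.mem_Icc]
    constructor <;> omega
  calc ((Finset.univ : Finset (Fin d → ZMod s)).filter fun b => ∀ i, (b i - a i).valMinAbs.natAbs ≤ 1).card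
      ≤ (Fintype.piFinset fun _ : Fin d => Finset.Icc (-1 : ℤ) 1).card := card_le_card_of_injOn _ hmaps hinj
    _ = 3 ^ d := by rw [Fintype.card_piFinset_const]; simp

/-! ## §2. THE END: the large-set separation for cubes on the torus -/

/-- **THE LARGE-SET SEPARATION FOR CUBES ON THE TORUS.**  For every `ℓ^∞`-connected set `Y` of sites of the fine torus `(ℤ∕(n+1)s)^d`, with blocks the
cubes of side `n+1` (block of `x` = `(⌊val x_i∕(n+1)⌋)_i` on `(ℤ∕s)^d`):
`⌊((n+1)∕2 + 1)∕(3^d + 1)⌋·(#B(Y) − (3^d + 1)) + 1 ≤ #Y` — (360)'s hypothesis `hsep` with `m = 3^d + 1`, `ℓ = ⌊((n+1)∕2 + 1)∕(3^d + 1)⌋`. [folklore] -/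
theorem torus_largeSet_separation {Y : Finset (Fin d → ZMod ((n + 1) * s))}
    (hY : IsRConnected (fun (a b : Fin d → ZMod ((n + 1) * s)) => ∀ i, (a i - b i).valMinAbs.natAbs ≤ 1) Y) :
    ((n + 1) / 2 + 1) / (3 ^ d + 1) *
        ((Y.image fun (x : Fin d → ZMod ((n + 1) * s)) (i : Fin d) => (((x i).val / (n + 1) : ℕ) : ZMod s)).card - (3 ^ d + 1)) + 1 ≤
      Y.card := by
  classical
  refine largeSet_separation_of_potentials (R := fun (a b : Fin d → ZMod ((n + 1) * s)) => ∀ i, (a i - b i).valMinAbs.natAbs ≤ 1)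
    (R' := fun (a b : Fin d → ZMod s) => ∀ i, (b i - a i).valMinAbs.natAbs ≤ 1) hY _ (fun a b h i => ?_)
    (nbr' := fun a => (Finset.univ : Finset (Fin d → ZMod s)).filter fun b => ∀ i, (b i - a i).valMinAbs.natAbs ≤ 1)
    (fun a => card_linfNbr_le a) (fun a b h => mem_filter.2 ⟨mem_univ _, h⟩) (r := (n + 1) / 2) fun x _ y _ _ hnot => ?_
  · -- symmetry of the block adjacency
    rw [← neg_sub, ZMod.natAbs_valMinAbs_neg]; exact h i
  · -- a far coordinate gives the Lipschitz potential `a ↦ |valMinAbs(a_i − y_i)|`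
    obtain ⟨i, hi⟩ : ∃ i, ¬ ((((((y i).val / (n + 1) : ℕ) : ZMod s) -
        (((x i).val / (n + 1) : ℕ) : ZMod s)).valMinAbs.natAbs) ≤ 1) := not_forall.1 hnot
    have hfar : 2 ≤ ((((x i).val / (n + 1) : ℕ) : ZMod s) - (((y i).val / (n + 1) : ℕ) : ZMod s)).valMinAbs.natAbs := by
      rw [← neg_sub, ZMod.natAbs_valMinAbs_neg]; omega
    refine ⟨fun a => (((a i - y i).valMinAbs.natAbs : ℕ) : ℤ), fun a b hab => lipschitz_coordSize a b y i (hab i), ?_⟩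
    have hgap := coord_gap_of_far_blocks x y i hfar
    show ((2 * ((n + 1) / 2) + 1 : ℕ) : ℤ) ≤ |(((x i - y i).valMinAbs.natAbs : ℕ) : ℤ) - (((y i - y i).valMinAbs.natAbs : ℕ) : ℤ)|
    rw [sub_self, ZMod.valMinAbs_zero, Int.natAbs_zero, Nat.cast_zero, sub_zero, Nat.abs_cast]
    have h2r : 2 * ((n + 1) / 2) + 1 ≤ n + 2 := by omega
    exact_mod_cast h2r.trans hgap

/-! ## §3. Toy -/

omit [NeZero s] in
/-- Toy (§1): the decomposition of a fine residue with block side `n + 1 = 1` (every site its own block). -/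
example (a : ZMod ((0 + 1) * s)) : a = (((0 + 1) * (a.val / (0 + 1)) + a.val % (0 + 1) : ℕ) : ZMod ((0 + 1) * s)) := fine_eq_cast a

end Summit.QuantumFields.BalabanUV.T4Continuum.NE7b.SupTorusCubeSeparation
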